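import Summits.CriticalPhenomena.PercolationContinuityZ3.Theorems.PercNearOneGluingNoHeavyPcintNawRandMem
import HarnessLib

/-!
# PCINT lane, reduced-state B2r certificates: lattice symmetry and table certificates

Cell `prim-pcint` (PAPER-2 track (iii)), seat `prim-pcint-1` (gen 5); support file (`--supports stmt-CriticalPhenomena-4575`).
Does NOT build on p205010.  Companion of `…PcintNawRandMem` (the B2r automaton `nawMemAut τ` on dangerous-set states).

* EQUIVARIANCE under the hyperoctahedral group (`SPerm d`, `smulSite`/`smulLetter`/`smulState` of `…PcintMemCertSym`):
  `adj_smulSite_iff`, `nstep_smul`, `ngap_smul`, `ncorner_smul`, `nwt_smul`, hence `total_nawMemAut_smul` (totals are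
  invariant) — a certificate may list ONE state per symmetry class.
* TABLE CERTIFICATES: rows `i : Fin N` carry a state `R i`, a weight `V i ≥ 1` and, per letter, either a rejection or a
  successor ROW together with the symmetry moving that row's state onto the true successor (`simRel`).  The index automaton
  `tableAut` then has the same totals as `nawMemAut` (`total_tableAut_eq`), and the Collatz–Wielandt inequalities on the
  rows bound the totals geometrically (`total_nawMemAut_le_of_table`), whence
  `le_siteCriticalProb_zd_of_nawMemTable : … → p ≤ p_c^site(ℤ^d)`.
The kernel arithmetic that discharges these hypotheses from explicit integer data is in `…PcintNawRandMemKernel*`.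

References: run/shared/lean/prim/pcint/REDUCTIONS.md §B2r, CERTIFICATE-FORMAT.md §B2 (lane files); A. Pönitz, P. Tittmann,
Electron. J. Combin. 7 (2000) R21 §3 (symmetry-reduced automata) [PonitzTittmann2000].
-/

noncomputable section

namespace Summit.CriticalPhenomena.PercolationContinuityZ3.Theorems.Pcint

open Finset Literature.Probability.Percolation Literature.Probability.LatticeModels

/-! ### Lattice symmetries: equivariance of the B2r automaton, invariance of totals -/

section SymB2r

variable {d : ℕ}

/-- The site action is additive. [folklore] -/
theorem smulSite_add (g : SPerm d) (x y : Site d) : smulSite g (x + y) = smulSite g x + smulSite g y := by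
  ext i; simp only [smulSite, Pi.add_apply]; split_ifs <;> ring

/-- **Adjacency is invariant** under lattice symmetries. [folklore] -/
theorem adj_smulSite_iff (g : SPerm d) (x y : Site d) :
    (zdGraph d).Adj (smulSite g x) (smulSite g y) ↔ (zdGraph d).Adj x y := by
  rw [zdGraph_adj_iff_stepVec, zdGraph_adj_iff_stepVec]
  constructor
  · rintro ⟨a', h⟩
    refine ⟨(letterEquiv g).symm a', smulSite_injective g ?_⟩
    rw [smulSite_add, ← stepVec_smulLetter, show smulLetter g ((letterEquiv g).symm a') = letterEquiv g
      ((letterEquiv g).symm a') from rfl, Equiv.apply_symm_apply, h]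
  · rintro ⟨a, rfl⟩
    exact ⟨smulLetter g a, by rw [smulSite_add, stepVec_smulLetter]⟩

/-- **Equivariance of the NAW step.** [folklore] -/
theorem nstep_smul (τ : ℕ) (g : SPerm d) (S : MState d) (a : Fin d × Bool) :
    nstep τ (smulState g S) (smulLetter g a) = (nstep τ S a).map (smulState g) := by
  unfold nstep
  have hcond : (∃ q ∈ smulState g S, (zdGraph d).Adj q.1 (stepVec (smulLetter g a))) ↔
      ∃ q ∈ S, (zdGraph d).Adj q.1 (stepVec a) := by
    rw [stepVec_smulLetter]
    constructor
    · rintro ⟨q, hq, hadj⟩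
      obtain ⟨r, hr, hqr⟩ := (mem_smulState g S q).1 hq
      exact ⟨(r, q.2), hr, (adj_smulSite_iff g _ _).1 (by rw [← hqr]; exact hadj)⟩
    · rintro ⟨q, hq, hadj⟩
      refine ⟨(smulSite g q.1, q.2), (mem_smulState g S _).2 ⟨q.1, by simpa using hq, rfl⟩, ?_⟩
      exact (adj_smulSite_iff g _ _).2 hadj
  by_cases h : ∃ q ∈ S, (zdGraph d).Adj q.1 (stepVec a)
  · rw [if_pos (hcond.2 h), if_pos h]; rfl
  · rw [if_neg (fun h' => h (hcond.1 h')), if_neg h, mstep_smul]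

/-- Lattice neighbourhoods are equivariant. [folklore] -/
theorem nbrSites_smulSite (g : SPerm d) (x : Site d) : nbrSites (smulSite g x) = (nbrSites x).image (smulSite g) := by
  ext w
  rw [mem_nbrSites, mem_image]
  constructor
  · intro h
    obtain ⟨a', ha'⟩ := (zdGraph_adj_iff_stepVec _ _).1 h
    refine ⟨x + stepVec ((letterEquiv g).symm a'), mem_nbrSites.2 ((zdGraph_adj_iff_stepVec _ _).2 ⟨_, rfl⟩), ?_⟩
    rw [smulSite_add, ← stepVec_smulLetter, show smulLetter g ((letterEquiv g).symm a') = letterEquiv g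
      ((letterEquiv g).symm a') from rfl, Equiv.apply_symm_apply, ha']
  · rintro ⟨w', hw', rfl⟩
    exact (adj_smulSite_iff g _ _).2 (mem_nbrSites.1 hw')

/-- **The detected gap set is equivariant.** [folklore] -/
theorem ngapSet_smul (g : SPerm d) (S : MState d) (a : Fin d × Bool) :
    ngapSet (smulState g S) (smulLetter g a) = (ngapSet S a).image (smulSite g) := by
  ext w
  rw [ngapSet, ngapSet, mem_filter, mem_image, stepVec_smulLetter, nbrSites_smulSite, mem_image]
  constructor
  · rintro ⟨⟨w', hw', rfl⟩, q, hq, hq2, hadj⟩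
    obtain ⟨r, hr, hqr⟩ := (mem_smulState g S q).1 hq
    exact ⟨w', mem_filter.2 ⟨hw', (r, q.2), hr, hq2, (adj_smulSite_iff g _ _).1 (by rw [← hqr]; exact hadj)⟩, rfl⟩
  · rintro ⟨w', hw', rfl⟩
    obtain ⟨hw'n, q, hq, hq2, hadj⟩ := mem_filter.1 hw'
    exact ⟨⟨w', hw'n, rfl⟩, (smulSite g q.1, q.2), (mem_smulState g S _).2 ⟨q.1, by simpa using hq, rfl⟩, hq2,
      (adj_smulSite_iff g _ _).2 hadj⟩

/-- **The detected gap count is invariant.** [folklore] -/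
theorem ngap_smul (g : SPerm d) (S : MState d) (a : Fin d × Bool) :
    ngap (smulState g S) (smulLetter g a) = ngap S a := by
  unfold ngap
  rw [ngapSet_smul, card_image_of_injective _ (smulSite_injective g)]

/-- Evaluating a transformed site on the axis of a transformed letter. [folklore] -/
theorem smulSite_apply_smulLetter_fst (g : SPerm d) (x : Site d) (a : Fin d × Bool) :
    smulSite g x (smulLetter g a).1 = 0 ↔ x a.1 = 0 := by
  simp only [smulSite, smulLetter, Equiv.apply_symm_apply]
  split_ifs <;> simp

/-- **The claimed corner is invariant.** [folklore] -/
theorem ncorner_smul (g : SPerm d) (S : MState d) (a : Fin d × Bool) :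
    ncorner (smulState g S) (smulLetter g a) = ncorner S a := by
  unfold ncorner
  rw [Bool.eq_iff_iff, decide_eq_true_iff, decide_eq_true_iff]
  constructor
  · rintro ⟨q₁, hq₁, h1, hperp, hfree⟩
    obtain ⟨r₁, hr₁, hqr₁⟩ := (mem_smulState g S q₁).1 hq₁
    rw [h1] at hr₁
    refine ⟨(r₁, 1), hr₁, rfl, (smulSite_apply_smulLetter_fst g r₁ a).1 (by rw [← hqr₁]; exact hperp), ?_⟩
    intro q hq hq2 hadj
    refine hfree (smulSite g q.1, q.2) ((mem_smulState g S _).2 ⟨q.1, by simpa using hq, rfl⟩) hq2 ?_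
    rw [hqr₁, stepVec_smulLetter, ← smulSite_add]
    exact (adj_smulSite_iff g _ _).2 hadj
  · rintro ⟨q₁, hq₁, h1, hperp, hfree⟩
    refine ⟨(smulSite g q₁.1, 1), (mem_smulState g S _).2 ⟨q₁.1, ?_, rfl⟩, rfl,
      (smulSite_apply_smulLetter_fst g q₁.1 a).2 hperp, ?_⟩
    · rw [← h1]; simpa using hq₁
    · intro q hq hq2 hadj
      obtain ⟨r, hr, hqr⟩ := (mem_smulState g S q).1 hq
      refine hfree (r, q.2) hr hq2 ((adj_smulSite_iff g _ _).1 ?_)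
      rw [smulSite_add, ← stepVec_smulLetter, ← hqr]
      exact hadj

/-- **The step factor is invariant.** [folklore] -/
theorem nwt_smul (qb κb : ℝ) (g : SPerm d) (S : MState d) (a : Fin d × Bool) :
    nwt qb κb (smulState g S) (smulLetter g a) = nwt qb κb S a := by
  unfold nwt; rw [ngap_smul, ncorner_smul]

/-- Row sums of `nawMemAut` against an invariant function are invariant. [folklore] -/
theorem stepSum_nawMemAut_smul {τ : ℕ} {p qb κb : ℝ} (hp : 0 ≤ p) (hqb : 0 ≤ qb) (hκb : 0 ≤ κb) (g : SPerm d)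
    {f : MState d → ℝ} (hf : ∀ T, f (smulState g T) = f T) (S : MState d) :
    (nawMemAut τ p qb κb hp hqb hκb).stepSum f (smulState g S) = (nawMemAut τ p qb κb hp hqb hκb).stepSum f S := by
  unfold WAut.stepSum
  rw [← Equiv.sum_comp (letterEquiv g)]
  refine Finset.sum_congr rfl fun a _ => ?_
  have h1 : (nawMemAut τ p qb κb hp hqb hκb).step (smulState g S) (letterEquiv g a) =
      ((nawMemAut τ p qb κb hp hqb hκb).step S a).map (smulState g) := nstep_smul τ g S a
  have h2 : (nawMemAut τ p qb κb hp hqb hκb).wt (smulState g S) (letterEquiv g a) =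
      (nawMemAut τ p qb κb hp hqb hκb).wt S a := by
    show p * nwt qb κb (smulState g S) (smulLetter g a) = p * nwt qb κb S a
    rw [nwt_smul]
  rw [h1, h2]
  cases (nawMemAut τ p qb κb hp hqb hκb).step S a with
  | none => rfl
  | some T => simp only [Option.map_some, hf]

/-- **Totals of the B2r automaton are invariant under lattice symmetries.** [folklore] -/
theorem total_nawMemAut_smul {τ : ℕ} {p qb κb : ℝ} (hp : 0 ≤ p) (hqb : 0 ≤ qb) (hκb : 0 ≤ κb) (g : SPerm d) :
    ∀ (n : ℕ) (S : MState d),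
      (nawMemAut τ p qb κb hp hqb hκb).total n (smulState g S) = (nawMemAut τ p qb κb hp hqb hκb).total n S := by
  intro n
  induction n with
  | zero => intro S; rw [WAut.total_zero, WAut.total_zero]
  | succ n ih =>
    intro S
    rw [WAut.total_succ, WAut.total_succ]
    exact stepSum_nawMemAut_smul hp hqb hκb g (fun T => ih T) S

end SymB2r

/-! ### Table certificates modulo symmetry: a finite index automaton simulating `nawMemAut` -/

section Table

variable {d N : ℕ}

/-- The SIMULATION TEST between a computed successor and the table's successor datum: rejection matches rejection,
and an accepted successor `T` is the listed row's state moved by the listed symmetry. [folklore] -/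
def simRel (R : Fin N → MState d) : Option (MState d) → Option (Fin N × SPerm d) → Bool
  | none, none => true
  | some T, some jg => decide (T = smulState jg.2 (R jg.1))
  | _, _ => false

/-- The INDEX AUTOMATON of a table: states are row indices, transitions and weights are read off the table
(weights recomputed from the row's state). [folklore] -/
def tableAut (τ : ℕ) (p qb κb : ℝ) (hp : 0 ≤ p) (hqb : 0 ≤ qb) (hκb : 0 ≤ κb) (R : Fin N → MState d)
    (sc : Fin N → Fin d × Bool → Option (Fin N × SPerm d)) : WAut (Fin N) (Fin d × Bool) where
  step i a := (sc i a).map Prod.fst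
  wt i a := (nawMemAut τ p qb κb hp hqb hκb).wt (R i) a
  wt_nonneg i a := (nawMemAut τ p qb κb hp hqb hκb).wt_nonneg (R i) a

/-- **Simulation**: the index automaton of a table in simulation with `nawMemAut` has the same totals.
[folklore] -/
theorem total_tableAut_eq {τ : ℕ} {p qb κb : ℝ} (hp : 0 ≤ p) (hqb : 0 ≤ qb) (hκb : 0 ≤ κb)
    (R : Fin N → MState d) (sc : Fin N → Fin d × Bool → Option (Fin N × SPerm d))
    (hsim : ∀ i a, simRel R (nstep τ (R i) a) (sc i a) = true) :
    ∀ (n : ℕ) (i : Fin N), (tableAut τ p qb κb hp hqb hκb R sc).total n i =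
      (nawMemAut τ p qb κb hp hqb hκb).total n (R i) := by
  intro n
  induction n with
  | zero => intro i; rw [WAut.total_zero, WAut.total_zero]
  | succ n ih =>
    intro i
    rw [WAut.total_succ, WAut.total_succ]
    unfold WAut.stepSum
    refine Finset.sum_congr rfl fun a _ => ?_
    have h := hsim i a
    have e1 : (tableAut τ p qb κb hp hqb hκb R sc).step i a = (sc i a).map Prod.fst := rfl
    have e2 : (nawMemAut τ p qb κb hp hqb hκb).step (R i) a = nstep τ (R i) a := rfl
    rw [e1, e2]
    revert h
    generalize nstep τ (R i) a = oT
    generalize sc i a = oJ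
    intro h
    cases oT with
    | none =>
      cases oJ with
      | none => rfl
      | some jg => exact absurd h (by simp [simRel])
    | some T =>
      cases oJ with
      | none => exact absurd h (by simp [simRel])
      | some jg =>
        have hT : T = smulState jg.2 (R jg.1) := by simpa [simRel] using h
        simp only [Option.map_some]
        rw [ih jg.1, hT, total_nawMemAut_smul]
        rfl

/-- **Table certificate ⇒ geometric bound on the totals of `nawMemAut`.**  If the rows carry states `R i`, positive
weights `V i ≥ 1`, successor data in simulation with `nstep`, and satisfy the Collatz–Wielandt inequalities
`Σ_a p·nwt(R i,a)·V(succ) ≤ λ V i`, then `total n (R i) ≤ λⁿ V i` for every row. [folklore] -/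
theorem total_nawMemAut_le_of_table {τ : ℕ} {p qb κb lam : ℝ} (hp : 0 ≤ p) (hqb : 0 ≤ qb) (hκb : 0 ≤ κb)
    (hlam : 0 ≤ lam) (R : Fin N → MState d) (sc : Fin N → Fin d × Bool → Option (Fin N × SPerm d)) (V : Fin N → ℝ)
    (hV : ∀ i, 1 ≤ V i) (hsim : ∀ i a, simRel R (nstep τ (R i) a) (sc i a) = true)
    (hcw : ∀ i, (∑ a : Fin d × Bool, match sc i a with
      | none => 0
      | some jg => p * nwt qb κb (R i) a * V jg.1) ≤ lam * V i) (n : ℕ) (i : Fin N) :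
    (nawMemAut τ p qb κb hp hqb hκb).total n (R i) ≤ lam ^ n * V i := by
  rw [← total_tableAut_eq hp hqb hκb R sc hsim n i]
  have hcw' : ∀ i, (tableAut τ p qb κb hp hqb hκb R sc).stepSum V i ≤ lam * V i := fun i => by
    refine le_of_eq_of_le ?_ (hcw i)
    unfold WAut.stepSum
    refine Finset.sum_congr rfl fun a _ => ?_
    have e1 : (tableAut τ p qb κb hp hqb hκb R sc).step i a = (sc i a).map Prod.fst := rfl
    rw [e1]
    cases sc i a with
    | none => rfl
    | some jg => rfl
  have := (tableAut τ p qb κb hp hqb hκb R sc).total_le_of_cw one_pos hV hlam hcw' n i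
  rwa [div_one] at this

/-- **Reduced-state B2r certificate (table form) ⇒ `p ≤ p_c^site(ℤ^d)`.**  The row `i₀` with the empty state gives
the bound on the totals from `∅` needed by `le_siteCriticalProb_zd_of_nawMem_total`. [folklore] -/
theorem le_siteCriticalProb_zd_of_nawMemTable [NeZero d] {τ : ℕ} (hτ : 2 ≤ τ) (p : unitInterval)
    {q qb κb lam : ℝ} (hq0 : 0 ≤ q) (hqb : q ≤ qb) (hqb1 : qb ≤ 1) (hκb : (1 + qb) / 2 ≤ κb)
    (hpq : 1 - (p : ℝ) ≤ q ^ (2 * d - 1)) (hlam0 : 0 ≤ lam) (hlam1 : lam < 1)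
    (R : Fin N → MState d) (sc : Fin N → Fin d × Bool → Option (Fin N × SPerm d)) (V : Fin N → ℝ)
    (i₀ : Fin N) (h0 : R i₀ = ∅) (hV : ∀ i, 1 ≤ V i) (hsim : ∀ i a, simRel R (nstep τ (R i) a) (sc i a) = true)
    (hcw : ∀ i, (∑ a : Fin d × Bool, match sc i a with
      | none => 0
      | some jg => (p : ℝ) * nwt qb κb (R i) a * V jg.1) ≤ lam * V i) :
    (p : ℝ) ≤ siteCriticalProb (zdGraph d) 0 := by
  refine le_siteCriticalProb_zd_of_nawMem_total hτ p hq0 hqb hqb1 hκb hpq hlam0 hlam1 (C := V i₀) fun n => ?_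
  have h := total_nawMemAut_le_of_table p.2.1 (hq0.trans hqb) (by linarith) hlam0 R sc V hV hsim hcw n i₀
  rw [h0] at h
  exact h.trans_eq (mul_comm _ _)

end Table

end Summit.CriticalPhenomena.PercolationContinuityZ3.Theorems.Pcint
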